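import Literature.AlgebraicTopology.KTheory.CoverTrivial
import Mathlib.Analysis.InnerProductSpace.PiL2
import HarnessLib

/-!
# Caps of spheres are contractible; `K⁰(S¹) = ℤ` (`K̃⁰(S¹) = 0`)

* For a real inner product space `E` and `e ∈ E`, the closed **cap** `cap e = {x ∈ S(E) | 0 ≤ ⟪x, e⟫}`
  of the unit sphere is closed, `cap e ∪ cap (-e) = S(E)`, and for `e ≠ 0` it is **contractible**
  (`contractibleSpace_cap`: `(t, x) ↦ ((1-t)x + t e/‖e‖)/‖…‖`, the segment missing the origin,
  `segment_ne_zero`).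
* The circle `S¹ ⊆ ℝ²` (`S1 = sphere 0 1` in `EuclideanSpace ℝ (Fin 2)`): the two closed
  half-circles `cap eUp`, `cap (-eUp)` meet in two points (`finite_cap_inter_cap_neg`), so by
  `CoverTrivial.lean` the rank at `(1, 0)` is a bijection **`K⁰(S¹) ≃+ ℤ`** (`rankAtEquivS1`),
  every class is `rank • 1` (`eq_rank_smul_one_S1`) and **`K̃⁰(S¹) = 0`** (`reduced_S1_eq_bot`)
  — Husemöller, *Fibre Bundles*, Ch. 9 (5.2) / Ch. 11 Thm. 5.5 (`K̃(S¹) = 0`).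

Everything is proved; no named facts.

## References

* D. Husemöller, *Fibre Bundles*, 3rd ed. (1994) [HusemollerFibreBundles1994]: Ch. 11 Thm. 5.5
  ("the relations `K̃(S⁰) = ℤ` and `K̃(S¹) = 0` of 9(5.2)").
-/

noncomputable section

open Set RealInnerProductSpace Metric unitInterval

namespace Literature.AlgebraicTopology.KTheory

universe u

section Caps

variable {E : Type u} [NormedAddCommGroup E] [InnerProductSpace ℝ E]

/-- The closed **cap** of the unit sphere in the direction `e`: `{x ∈ S(E) | 0 ≤ ⟪x, e⟫}`
(a closed hemisphere when `e ≠ 0`). [folklore] -/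
def cap (e : E) : Set (sphere (0 : E) 1) := {x | 0 ≤ ⟪(x : E), e⟫}

/-- Auxiliary statement about caps / the circle. [folklore] -/
theorem mem_cap {e : E} {x : sphere (0 : E) 1} : x ∈ cap e ↔ 0 ≤ ⟪(x : E), e⟫ := Iff.rfl

/-- Caps are closed. [folklore] -/
theorem isClosed_cap (e : E) : IsClosed (cap e) :=
  isClosed_le continuous_const ((continuous_subtype_val).inner continuous_const)

/-- The two opposite caps cover the sphere. [folklore] -/
theorem cap_union_cap_neg (e : E) : cap e ∪ cap (-e) = univ := by
  ext x
  simp only [mem_union, mem_cap, inner_neg_right, mem_univ, iff_true]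
  rcases le_total 0 ⟪(x : E), e⟫ with h | h
  · exact Or.inl h
  · exact Or.inr (by linarith)

/-- On the cap of `e ≠ 0`, the segment from `x` to `e/‖e‖` misses the origin. [folklore] -/
theorem segment_ne_zero {e : E} (he : e ≠ 0) {x : sphere (0 : E) 1} (hx : x ∈ cap e) (t : I) :
    (1 - (t : ℝ)) • (x : E) + (t : ℝ) • (‖e‖⁻¹ • e) ≠ 0 := by
  intro h0
  have hxn : ‖(x : E)‖ = 1 := by simp
  have hinner : ⟪(1 - (t : ℝ)) • (x : E) + (t : ℝ) • (‖e‖⁻¹ • e), e⟫ = (1 - (t : ℝ)) * ⟪(x : E), e⟫ + (t : ℝ) * ‖e‖ := by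
    rw [inner_add_left, inner_smul_left, inner_smul_left, inner_smul_left, real_inner_self_eq_norm_sq]
    simp only [conj_trivial]
    field_simp
  rw [h0, inner_zero_left] at hinner
  have ht0 : (t : ℝ) = 0 := by
    by_contra ht
    have htpos : 0 < (t : ℝ) := lt_of_le_of_ne t.2.1 (Ne.symm ht)
    have h1 : 0 ≤ (1 - (t : ℝ)) * ⟪(x : E), e⟫ := mul_nonneg (by linarith [t.2.2]) hx
    have h2 : 0 < (t : ℝ) * ‖e‖ := mul_pos htpos (norm_pos_iff.2 he)
    linarith
  rw [ht0] at h0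
  simp only [sub_zero, one_smul, zero_smul, add_zero] at h0
  rw [h0, norm_zero] at hxn
  exact zero_ne_one hxn

/-- **Caps are contractible**: `(t, x) ↦ ((1-t)x + t e/‖e‖)/‖…‖` contracts `cap e` onto `e/‖e‖`
(`e ≠ 0`). [folklore] -/
theorem contractibleSpace_cap {e : E} (he : e ≠ 0) : ContractibleSpace (cap e) := by
  have hen : ‖e‖ ≠ 0 := norm_ne_zero_iff.2 he
  let pole : E := ‖e‖⁻¹ • e
  have hpole : pole ∈ sphere (0 : E) 1 := by
    simp [pole, norm_smul, hen]
  have hpolecap : (⟨pole, hpole⟩ : sphere (0 : E) 1) ∈ cap e := by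
    change 0 ≤ ⟪pole, e⟫
    rw [inner_smul_left, real_inner_self_eq_norm_sq]
    simp only [conj_trivial]
    positivity
  rw [contractible_iff_id_nullhomotopic]
  refine ⟨⟨⟨pole, hpole⟩, hpolecap⟩, ⟨?_⟩⟩
  let w : I × cap e → E := fun z ↦ (1 - (z.1 : ℝ)) • ((z.2 : sphere (0 : E) 1) : E) + (z.1 : ℝ) • pole
  have hw : Continuous w := by fun_prop
  have hw0 : ∀ z, w z ≠ 0 := fun z ↦ segment_ne_zero he z.2.2 z.1
  have hwn : Continuous fun z ↦ ‖w z‖⁻¹ • w z := (hw.norm.inv₀ fun z ↦ norm_ne_zero_iff.2 (hw0 z)).smul hw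
  have hsph : ∀ z, ‖w z‖⁻¹ • w z ∈ sphere (0 : E) 1 := fun z ↦ by
    simp [norm_smul, norm_ne_zero_iff.2 (hw0 z)]
  have hcap : ∀ z, (⟨‖w z‖⁻¹ • w z, hsph z⟩ : sphere (0 : E) 1) ∈ cap e := fun z ↦ by
    change 0 ≤ ⟪‖w z‖⁻¹ • w z, e⟫
    rw [inner_smul_left]
    simp only [conj_trivial]
    refine mul_nonneg (inv_nonneg.2 (norm_nonneg _)) ?_
    change 0 ≤ ⟪(1 - (z.1 : ℝ)) • ((z.2 : sphere (0 : E) 1) : E) + (z.1 : ℝ) • pole, e⟫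
    rw [inner_add_left, inner_smul_left, inner_smul_left]
    simp only [conj_trivial]
    have h1 : 0 ≤ ⟪pole, e⟫ := hpolecap
    exact add_nonneg (mul_nonneg (by linarith [z.1.2.2]) z.2.2) (mul_nonneg z.1.2.1 h1)
  refine
    { toFun := fun z ↦ ⟨⟨‖w z‖⁻¹ • w z, hsph z⟩, hcap z⟩
      continuous_toFun := by
        refine Continuous.subtype_mk (Continuous.subtype_mk hwn _) _
      map_zero_left := fun x ↦ ?_
      map_one_left := fun x ↦ ?_ }
  · apply Subtype.ext; apply Subtype.ext
    have hx : ‖((x : sphere (0 : E) 1) : E)‖ = 1 := by simp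
    simp [w, hx]
  · apply Subtype.ext; apply Subtype.ext
    have : ‖pole‖ = 1 := by simpa using hpole
    simp [w, this]

end Caps

/-! ### The circle: `K⁰(S¹) = ℤ` -/

section Circle

/-- The unit circle `S¹ ⊆ ℝ²`. [folklore] -/
abbrev S1 : Type := sphere (0 : EuclideanSpace ℝ (Fin 2)) 1

/-- The vertical unit vector `e₁ = (0, 1) ∈ ℝ²`. [folklore] -/
def eUp : EuclideanSpace ℝ (Fin 2) := EuclideanSpace.single 1 1

/-- Auxiliary statement about caps / the circle. [folklore] -/
theorem eUp_ne_zero : eUp ≠ 0 := by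
  intro h
  have := congrArg (fun v : EuclideanSpace ℝ (Fin 2) ↦ v 1) h
  simp [eUp] at this

/-- Auxiliary statement about caps / the circle. [folklore] -/
theorem inner_eUp (v : EuclideanSpace ℝ (Fin 2)) : ⟪v, eUp⟫ = v 1 := by
  rw [eUp, EuclideanSpace.inner_single_right]; simp

/-- The upper and lower closed half-circles meet in the two points `(±1, 0)`. [folklore] -/
theorem finite_cap_inter_cap_neg : (cap eUp ∩ cap (-eUp) : Set S1).Finite := by
  have hsub : (cap eUp ∩ cap (-eUp) : Set S1) ⊆ {x | (x : EuclideanSpace ℝ (Fin 2)) 1 = 0} := by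
    intro x ⟨h1, h2⟩
    rw [mem_cap, inner_eUp] at h1
    rw [mem_cap, inner_neg_right, inner_eUp] at h2
    change (x : EuclideanSpace ℝ (Fin 2)) 1 = 0
    linarith
  refine Set.Finite.subset ?_ hsub
  -- the set `{x ∈ S¹ | x₁ = 0}` injects into `{1, -1}` by `x ↦ x₀`
  apply Set.Finite.of_finite_image (f := fun x : S1 ↦ (x : EuclideanSpace ℝ (Fin 2)) 0)
  · refine ((Set.finite_singleton (-1 : ℝ)).insert 1).subset ?_
    rintro _ ⟨x, hx, rfl⟩
    change (x : EuclideanSpace ℝ (Fin 2)) 1 = 0 at hx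
    have hn : ‖(x : EuclideanSpace ℝ (Fin 2))‖ = 1 := by simp
    have hsq : (x : EuclideanSpace ℝ (Fin 2)) 0 ^ 2 = 1 := by
      have h := EuclideanSpace.norm_sq_eq (x : EuclideanSpace ℝ (Fin 2))
      rw [hn, Fin.sum_univ_two, hx] at h
      simpa using h.symm
    have hprod : ((x : EuclideanSpace ℝ (Fin 2)) 0 - 1) * ((x : EuclideanSpace ℝ (Fin 2)) 0 + 1) = 0 := by
      ring_nf; linarith
    rcases mul_eq_zero.1 hprod with h | h
    · exact Or.inl (by linarith)
    · exact Or.inr (by change _ = (-1 : ℝ); linarith)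
  · rintro x (hx : (x : EuclideanSpace ℝ (Fin 2)) 1 = 0) y (hy : (y : EuclideanSpace ℝ (Fin 2)) 1 = 0) (hxy : _ = _)
    apply Subtype.ext
    ext i
    fin_cases i
    · exact hxy
    · exact hx.trans hy.symm

/-- **`K⁰(S¹) = ℤ` by the rank** (`K̃(S¹) = 0`; Husemöller, *Fibre Bundles*, Ch. 9 (5.2) /
Ch. 11 Thm. 5.5): the circle is the union of two contractible closed half-circles meeting in
two points, over which every clutching function is null-homotopic because `GLᵣ(ℂ)` is path
connected. [cite: HusemollerFibreBundles1994, Ch. 11 Thm. 5.5] -/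
theorem rankAt_bijective_S1 (x₀ : S1) (hx₀ : x₀ ∈ cap eUp ∩ cap (-eUp)) : Function.Bijective (rankAt x₀ : K0 S1 → ℤ) := by
  haveI := contractibleSpace_cap eUp_ne_zero
  haveI := contractibleSpace_cap (neg_ne_zero.2 eUp_ne_zero)
  haveI : Finite ↥(cap eUp ∩ cap (-eUp)) := finite_cap_inter_cap_neg.to_subtype
  exact rankAt_bijective_of_cover (isClosed_cap _) (isClosed_cap _) (cap_union_cap_neg _) hx₀
    fun r g hg ↦ exists_nullhomotopy_of_discrete g hg

/-- The point `(1, 0) ∈ S¹`, which lies on both half-circles. [folklore] -/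
def s1Base : S1 := ⟨EuclideanSpace.single 0 1, by simp⟩

/-- Auxiliary statement about caps / the circle. [folklore] -/
theorem s1Base_mem : s1Base ∈ cap eUp ∩ cap (-eUp) := by
  constructor
  · rw [mem_cap, inner_eUp]; simp [s1Base]
  · rw [mem_cap, inner_neg_right, inner_eUp]; simp [s1Base]

/-- **`K⁰(S¹) ≃+ ℤ`** by the rank at `(1, 0)`. [cite: HusemollerFibreBundles1994, Ch. 11 Thm. 5.5] -/
def rankAtEquivS1 : K0 S1 ≃+ ℤ := AddEquiv.ofBijective (rankAt s1Base) (rankAt_bijective_S1 s1Base s1Base_mem)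

/-- Auxiliary statement about caps / the circle. [folklore] -/
@[simp] theorem rankAtEquivS1_apply (a : K0 S1) : rankAtEquivS1 a = rankAt s1Base a := rfl

/-- Every element of `K⁰(S¹)` is a multiple of `[1]`: `a = rank(a) • 1`. [cite: HusemollerFibreBundles1994, Ch. 11 Thm. 5.5] -/
theorem eq_rank_smul_one_S1 (a : K0 S1) : a = (rankAt s1Base a : ℤ) • (1 : K0 S1) := by
  apply rankAtEquivS1.injective
  rw [rankAtEquivS1_apply, rankAtEquivS1_apply, map_zsmul, rankAt_one, smul_eq_mul, mul_one]

/-- The reduced group of the circle vanishes: `K̃⁰(S¹) = 0`. [cite: HusemollerFibreBundles1994, Ch. 11 Thm. 5.5] -/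
theorem reduced_S1_eq_bot : Reduced S1 s1Base = ⊥ := by
  rw [eq_bot_iff]
  intro a ha
  rw [AddSubgroup.mem_bot]
  rw [mem_reduced_iff] at ha
  rw [eq_rank_smul_one_S1 a, ha, zero_smul]

end Circle


end Literature.AlgebraicTopology.KTheory

end
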